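import Literature.MathematicalPhysics.QuantumFieldTheory.Balaban1983to89.B2Ineq329BlockPoincare
import Literature.MathematicalPhysics.QuantumFieldTheory.Balaban1983to89.B1Cor23ZeroFieldRegion
import Literature.MathematicalPhysics.QuantumFieldTheory.Balaban1983to89.B2Sect2BDensities

/-!
# `Balaban1983to89.B2Eq244Cutoff` — [Balaban1982Higgs2] (2.44) p. 566: the cut-off `ζ^{(k)}(x, y)` CONSTRUCTED on the
(Higgs)₂,₃ carrier `HiggsLattice` (fine torus `T_ε`, block labels `T^{(k)}_{Lᵏε}`), with its four printed properties PROVED in the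
block-label currency of r14's `B2Lemma23HiggsLattice.lemma23_higgsLattice` / p23's `B2Prop31MinimizerFamily.RMultiM.ζ_*`

statement-level skeleton of published theorems with citation tags; proofs where landed; nothing here is a claim about the Yang–Mills mass gap

CITATION HEADER.  T. Bałaban, *(Higgs)₂,₃ quantum fields in a finite volume. II. An upper bound*, Commun. Math. Phys. **86**
(1982) 555–594 [Balaban1982Higgs2] (PDF held `paper:balaban1982-cmp86-higgs23-ii`, journal page = PDF page + 554; p. 566 read on the
×2 render `run/shared/lean/pub/pub-balaban/b2b-balaban-ref1/pages/1982-cmp86-higgs23-II/1982-cmp86-higgs23-II-p012-x2.png`); part I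
[Balaban1982Higgs1] (1.3) p. 604, (1.17)–(1.20) pp. 606–607.  Cell `lit-balaban` (HOME `run/shared/lean/pub/lit-balaban/`), Phase-2
proof seat **p23** gen 12 (unit `lit-balaban-p23-g12`; TAKING line HOME/STATUS.md 2026-08-22T02:39:47Z; owner r02's note
`lit-balaban-p23/INBOX.md` 02:21:38Z/02:21:55Z).  SKELETON row **B2.Eq2.44** (owner r02, second reader r14; decl of record r14's
`B2StepK.aEps244`/`IsCutoff244`, abstract witness r14 g4 `B2Sect2BDensities.zetaClamp_isCutoff244` p248067); consumers: rows **B2.Prop3.1** /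
**B2.Eq3.29** (p23 g11 `B2Prop31MinimizerFamily.RMultiM`, whose fields `ζ_abs`/`ζ_supp`/`ζ_one`/`ζ_lip` are exactly §4 below) and
**B2.Lem2.3** (r14 g11 `B2Lemma23HiggsLattice.lemma23_higgsLattice`, hypotheses `habs`/`hsupp`/`hone`/`hlip`).  USED BY NAME, NOTHING
RESTATED: r14's `B2Sect2BDensities.{zetaClamp, zetaClamp_isCutoff244, diffQuot}` (the clamp profile over an ABSTRACT distance), the typer's
`HiggsLattice.{Site, Site.tdist, Site.shift}`, `HiggsAveraging.{toFinest, blockIter}`, the torus arithmetic of p15 `B2Ineq329ZeroAveraging.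
sitesPerDir_zero_eq`, p23 g9 `B2Ineq329PrismHolonomy.val_toFinest` / `B2Ineq329BlockPoincare.blockIter_toFinest`, b04/p35
`B1Ineq234Concrete.{mul_tdist_blockIter_le, tdist_blockIter_le_real}`, `B1Ineq234LevelZero.{tdist_shift_le_one, tdist_comm, tdist_triangle_real}`,
`B1Cor23ZeroFieldRegion.tdist_le_of_blockIter_eq_real`, and `Literature.NumberTheory.LFunctions.PlateauMollifier.abs_clamp_sub_clamp_le`.

WHAT IS PRINTED ((2.44) p. 566, verbatim).  *"A^{(k),ε} = a_k(Lᵏε)^{−2}ζ^{(k)}G^ε_kQ*_kA, (2.44) where the function ζ^{(k)}(x, y) is defined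
for x ∈ T_η, y ∈ T₁^{(k)}, is "smooth" with respect to x in the sense that |(∂^η_xζ^{(k)})(b, y)| ≦ 1, supp ζ^{(k)}(·, y) is contained in
the set {x ∈ T_η : |x − y| < r(Lᵏε) − 2M} and ζ^{(k)}(x, y) = 1 if |x − y| ≦ ½r(Lᵏε)."*  The paper posits such a function; its existence
(a piecewise-linear or smooth profile of the distance) is not spelled out.  r14 g4 proved it over an ABSTRACT real distance `dist : X → Y → ℝ`
with the hypothesis that `dist(·, y)` moves by `≤ η` across an `η`-bond (`zetaClamp_isCutoff244`); the CARRIER statements of the cell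
(r14 g11, p23 g11) read `|x − y|` as the block-label distance `|x_k − y′|_{T^{(k)}}` (`Site.tdist (blockIter k x) y′`), which is piecewise
CONSTANT in the fine point `x` — so a profile of it alone cannot be `L^{−k}`-Lipschitz per fine step (owner r02, 02:21:55Z).  This file
supplies the concrete distance that works and the comparison lemmas.

THE CONSTRUCTION (§2–§3).  `distK k x y′ := |x − Lᵏy′|_{T_ε} / Lᵏ` — the sup-distance (I.1.3) on the fine torus from `x` to the corner
`toFinest y′` of the block `Bᵏ(y′)`, in level-`k` units.  One fine step moves it by `≤ L^{−k}` (§2 `abs_distK_shift_sub_le`), and it is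
comparable with the block-label distance: `|x_k − y′| ≤ distK + 1 − L^{−k}` (`B1Ineq234Concrete.mul_tdist_blockIter_le`) and
`distK ≤ |x_k − y′| + 1 − L^{−k}` (the block of `x` has diameter `Lᵏ − 1`, and the embedding `T^{(k)} ↪ T_ε` scales (1.3) by `Lᵏ`:
§1 `tdist_toFinest_le`, NEW).  Then `zeta244 k ρ := zetaClamp (ρ − 1) (distK k)`, i.e. `ζ(x, y′) = max(0, min(1, ρ − 1 − distK(x, y′)))`:
values in `[0, 1]`; `ζ ≠ 0 ⇒ |x_k − y′| ≤ ρ` (indeed `< ρ`); `|x_k − y′| ≤ ρ₁ ⇒ ζ = 1` whenever `ρ₁ + 3 ≤ ρ`; `|ζ(x + εe_ν, y′) − ζ(x, y′)| ≤ L^{−k}`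
— for EVERY torus of the family, every level `k ≤ K` (genuine blocks), every radius.  With `ρ = r(Lᵏε) = R(1 + log(Lᵏε)⁻¹)^r ≥ R`
(`Lᵏε ≤ 1`, `r ≥ 0`) the printed plateau `½r(Lᵏε)` needs `r(Lᵏε) ≥ 6`, i.e. `R ≥ 6` — a largeness of `R` in the sense of (2.7) p. 558,
verbatim *"The numbers r, R satisfy r > 1, R > R₀ (R₀ occurs in the formulation of Proposition I.2.1)."* (v1.1: quote made verbatim).

WHAT THIS MODULE PROVES (kernel-checked, 0 `sorry`, standard axioms; definitions with bodies `distK`, `zeta244`; no `Prop` facts).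
 §1 `tdist_toFinest_le` (`|Lᵏy − Lᵏy′|_{T_ε} ≤ Lᵏ|y − y′|_{T^{(k)}}`, `k ≤ K`);
 §2 `distK`, `distK_nonneg`, `abs_distK_shift_sub_le`, `tdist_blockIter_le_distK`, `distK_le_tdist_blockIter`;
 §3 `zeta244`, `zeta244_apply`, `zeta244_nonneg`, `zeta244_le_one`, `abs_zeta244_le_one`, `zeta244_lip`, `zeta244_supp` (`k ≤ K`),
    `zeta244_eq_one` (`k ≤ K`, `ρ₁ + 3 ≤ ρ`), and the bridge `isCutoff244_distK` (r14's abstract predicate `B2StepK.IsCutoff244` holds on the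
    carrier for `zetaClamp (r − 2M) (distK k)` with the distance `distK`, `r ≥ 4M + 2`);
 §4 the printed radius: `le_rFn` (`R ≤ r(s)` for `0 < s ≤ 1`, `R, r ≥ 0`), **`zeta244_cutoff244`** (the four clauses of
    `RMultiM.ζ_*` / `lemma23_higgsLattice` for `zeta244 k (r(Lᵏε))` at every level `k ≤ K` with `Lᵏε ≤ 1`, given `R ≥ 6`, `r ≥ 0`);
 §5 (v1.1, append-only) the PRINTED support set: `zeta244_supp_lt` (STRICT: `ζ ≠ 0 ⇒ |x_k − y′| < ρ`, indeed `≤ ρ − L^{−k}`) and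
    **`zeta244_cutoff244_printed`** — with `ζ^{(k)} := zeta244 k (r(Lᵏε) − 2M)`: `|ζ| ≤ 1`, `ζ(x, y′) ≠ 0 ⇒ |x_k − y′| < r(Lᵏε) − 2M` (the
    printed set, strict), `|x_k − y′| ≤ ½r(Lᵏε) ⇒ ζ = 1`, Lipschitz `L^{−k}`, for every `k ≤ K`, `Lᵏε ≤ 1`, given `M ≥ 0`, `R ≥ 4M + 6`, `r ≥ 0`.
HONEST SCOPE.  (i) §3–§4 prove the support clause with radius `ρ` (as the cell's carrier statements ask); §5 gives the printed set
`{|x − y| < r(Lᵏε) − 2M}` together with the printed plateau, at the price `R ≥ 4M + 6` (`M` = the large-block size, a fixed integer).  (ii) *"smooth"* is read, as printed, as the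
difference-quotient bound `|∂^η_xζ| ≤ 1` on the unit lattice = `L^{−k}` per fine step; no higher smoothness is claimed or needed by the
consumers.  (iii) Levels `k > K` (where the typer's tori degenerate and `r(Lᵏε)` is not `≥ R`) are not covered: §2–§3's comparison lemmas
use `k ≤ K`.  (iv) No row head changes are claimed (owner r02).  Nothing here is summit progress.
-/

noncomputable section

open Finset Real
open scoped BigOperators

namespace Literature.MathematicalPhysics.QuantumFieldTheory.Balaban1983to89.B2Eq244Cutoff

open Literature.MathematicalPhysics.QuantumFieldTheory.Balaban1983to89.HiggsLattice
open Literature.MathematicalPhysics.QuantumFieldTheory.Balaban1983to89.HiggsAveraging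
open Literature.MathematicalPhysics.QuantumFieldTheory.Balaban1983to89.B2Ineq329ZeroAveraging (sitesPerDir_zero_eq)
open Literature.MathematicalPhysics.QuantumFieldTheory.Balaban1983to89.B2Ineq329PrismHolonomy (val_toFinest)
open Literature.MathematicalPhysics.QuantumFieldTheory.Balaban1983to89.B2Ineq329BlockPoincare (blockIter_toFinest)
open Literature.MathematicalPhysics.QuantumFieldTheory.Balaban1983to89.B1Ineq234Concrete (mul_tdist_blockIter_le tdist_blockIter_le_real)
open Literature.MathematicalPhysics.QuantumFieldTheory.Balaban1983to89.B1Ineq234LevelZero (tdist_shift_le_one tdist_comm tdist_triangle_real)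
open Literature.MathematicalPhysics.QuantumFieldTheory.Balaban1983to89.B1Cor23ZeroFieldRegion (tdist_le_of_blockIter_eq_real)
open B2Sect2BDensities (zetaClamp zetaClamp_mem_Icc zetaClamp_isCutoff244 diffQuot)

variable {P : HiggsLattice.Params} {k : ℕ}

/-! ## §1 The embedding `T^{(k)} ↪ T_ε` scales the distance (1.3) by `Lᵏ` -/

/-- `(b − a) mod n = n − ((a − b) mod n)` for `a ≠ b` in `ℤ/nℤ`. [folklore] [cite: Balaban1982Higgs1, (1.3) p.604] -/
private theorem val_sub_rev {n : ℕ} [NeZero n] {a b : ZMod n} (h : a ≠ b) : (b - a).val = n - (a - b).val := by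
  rw [← neg_sub, ZMod.neg_val, if_neg (sub_ne_zero.mpr h)]

/-- One coordinate: for labels `a = ℓA`, `b = ℓB` of `ℤ/ℓmℤ` (`A, B ∈ ℤ/mℤ`), `dist(a − b, ℓmℤ) ≤ ℓ·dist(A − B, mℤ)` (in fact `=`).
[folklore] [cite: Balaban1982Higgs1, (1.20) p.607] -/
private theorem circ_emb_le {n m ℓ : ℕ} [NeZero n] [NeZero m] (hn : n = ℓ * m) (hℓ : 0 < ℓ)
    (a b : ZMod n) (A B : ZMod m) (hA : a.val = A.val * ℓ) (hB : b.val = B.val * ℓ) :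
    min (a - b).val (b - a).val ≤ ℓ * min (A - B).val (B - A).val := by
  wlog hBA : B.val ≤ A.val generalizing a b A B
  · have h := this b a B A hB hA (not_le.mp hBA).le
    rwa [min_comm (b - a).val, min_comm (B - A).val] at h
  have hba : b.val ≤ a.val := by rw [hA, hB]; exact Nat.mul_le_mul_right _ hBA
  have h1 : (a - b).val = ℓ * (A - B).val := by
    rw [ZMod.val_sub hba, ZMod.val_sub hBA, hA, hB, ← Nat.sub_mul, mul_comm]
  by_cases hAB : A = B
  · subst hAB
    have hab : a = b := ZMod.val_injective _ (by rw [hA, hB])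
    subst hab
    simp
  · have hab : a ≠ b := by
      intro h
      apply hAB
      apply ZMod.val_injective
      have := congrArg ZMod.val h
      rw [hA, hB] at this
      exact Nat.eq_of_mul_eq_mul_right hℓ this
    have h2 : (b - a).val = ℓ * (B - A).val := by
      rw [val_sub_rev hab, val_sub_rev hAB, h1, hn, ← mul_tsub]
    rcases le_total (A - B).val (B - A).val with h | h
    · rw [min_eq_left h, ← h1]
      exact min_le_left _ _
    · rw [min_eq_right h, ← h2]
      exact min_le_right _ _

/-- **The inclusion `T^{(k)}_{Lᵏε} ⊂ T_ε` scales the distance (1.3)**: `|Lᵏy − Lᵏy′|_{T_ε} ≤ Lᵏ·|y − y′|_{T^{(k)}}` in lattice units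
(`k ≤ K`; labels `v ↦ Lᵏv`, `HiggsAveraging.toFinest`). [cite: Balaban1982Higgs1, (1.3) p.604, (1.20) p.607] -/
theorem tdist_toFinest_le (hk : k ≤ P.K) (y y' : HiggsLattice.Site P k) :
    HiggsLattice.Site.tdist (toFinest y) (toFinest y') ≤ P.L ^ k * HiggsLattice.Site.tdist y y' := by
  unfold HiggsLattice.Site.tdist
  refine Finset.sup_le fun ν _ => ?_
  have h := circ_emb_le (sitesPerDir_zero_eq hk ν) (pow_pos P.hL k) ((toFinest y) ν) ((toFinest y') ν) (y ν) (y' ν)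
    (val_toFinest hk y ν) (val_toFinest hk y' ν)
  refine h.trans (Nat.mul_le_mul_left _ ?_)
  exact Finset.le_sup (f := fun μ : Fin P.d => min (y μ - y' μ).val (y' μ - y μ).val) (Finset.mem_univ ν)

/-! ## §2 The distance `distK`: fine sup-distance to the block corner, in level-`k` units -/

/-- **The concrete distance of the construction**: `distK k x y′ = |x − Lᵏy′|_{T_ε}/Lᵏ` — the sup-distance (I.1.3) on the fine torus
from `x ∈ T_ε` to the corner `toFinest y′` of the block `Bᵏ(y′)`, `y′ ∈ T^{(k)}`, measured in units of `Lᵏε`-blocks (a FINE-point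
dependent proxy for the printed `|x − y|`, `x ∈ T_η`, `y ∈ T₁^{(k)}`). [cite: Balaban1982Higgs2, (2.44) p.566] [cite: Balaban1982Higgs1, (1.3) p.604] -/
def distK (P : HiggsLattice.Params) (k : ℕ) (x : HiggsLattice.Site P 0) (y' : HiggsLattice.Site P k) : ℝ :=
  (HiggsLattice.Site.tdist x (toFinest y') : ℝ) / (P.L : ℝ) ^ k

/-- `distK ≥ 0`. [cite: Balaban1982Higgs1, (1.3) p.604] -/
theorem distK_nonneg (x : HiggsLattice.Site P 0) (y' : HiggsLattice.Site P k) : 0 ≤ distK P k x y' :=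
  div_nonneg (Nat.cast_nonneg _) (pow_nonneg (Nat.cast_nonneg _) _)

/-- **One fine step moves `distK` by at most `L^{−k}`** (the triangle inequality for (1.3) and `|x − (x + εe_ν)| ≤ 1`): the `hLip`
hypothesis of r14's `zetaClamp_isCutoff244` ON THE CARRIER, `η = L^{−k}`. [cite: Balaban1982Higgs2, (2.44) p.566] [cite: Balaban1982Higgs1, (1.3) p.604] -/
theorem abs_distK_shift_sub_le (x : HiggsLattice.Site P 0) (ν : Fin P.d) (y' : HiggsLattice.Site P k) :
    |distK P k (x.shift ν) y' - distK P k x y'| ≤ ((P.L : ℝ) ^ k)⁻¹ := by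
  have hℓ : (0 : ℝ) < (P.L : ℝ) ^ k := pow_pos (by exact_mod_cast P.hL) k
  unfold distK
  rw [← sub_div, abs_div, abs_of_pos hℓ, div_le_iff₀ hℓ, inv_mul_cancel₀ hℓ.ne']
  have h1 := tdist_triangle_real (x.shift ν) x (toFinest y')
  have h2 := tdist_triangle_real x (x.shift ν) (toFinest y')
  have h3 : (HiggsLattice.Site.tdist x (x.shift ν) : ℝ) ≤ 1 := by exact_mod_cast tdist_shift_le_one x ν
  have h4 : (HiggsLattice.Site.tdist (x.shift ν) x : ℝ) ≤ 1 := by rw [tdist_comm]; exact h3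
  rw [abs_le]
  constructor <;> linarith

/-- **Coarse below fine**: `|x_k − y′|_{T^{(k)}} ≤ distK(x, y′) + 1 − L^{−k}` (`k ≤ K`) — `B1Ineq234Concrete.mul_tdist_blockIter_le`
(`Lᵏ|x_k − x′_k| ≤ |x − x′| + Lᵏ − 1`) at `x′ = Lᵏy′`, whose `k`-block label is `y′`. [cite: Balaban1982Higgs1, (1.20) p.607] -/
theorem tdist_blockIter_le_distK (hk : k ≤ P.K) (x : HiggsLattice.Site P 0) (y' : HiggsLattice.Site P k) :
    (HiggsLattice.Site.tdist (blockIter k x) y' : ℝ) ≤ distK P k x y' + 1 - ((P.L : ℝ) ^ k)⁻¹ := by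
  have h := tdist_blockIter_le_real hk x (toFinest y')
  rw [blockIter_toFinest hk y'] at h
  unfold distK
  exact h

/-- **Fine below coarse**: `distK(x, y′) ≤ |x_k − y′|_{T^{(k)}} + 1 − L^{−k}` (`k ≤ K`): `x` is within `Lᵏ − 1` of the corner of its own
block (`B1Cor23ZeroFieldRegion.tdist_le_of_blockIter_eq_real`) and the corners are `Lᵏ|x_k − y′|` apart (§1).
[cite: Balaban1982Higgs1, (1.3) p.604, (1.20) p.607] -/
theorem distK_le_tdist_blockIter (hk : k ≤ P.K) (x : HiggsLattice.Site P 0) (y' : HiggsLattice.Site P k) :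
    distK P k x y' ≤ (HiggsLattice.Site.tdist (blockIter k x) y' : ℝ) + 1 - ((P.L : ℝ) ^ k)⁻¹ := by
  have hℓ : (0 : ℝ) < (P.L : ℝ) ^ k := pow_pos (by exact_mod_cast P.hL) k
  have h1 := tdist_triangle_real x (toFinest (blockIter k x)) (toFinest y')
  have h2 : (HiggsLattice.Site.tdist x (toFinest (blockIter k x)) : ℝ) ≤ (P.L : ℝ) ^ k - 1 :=
    tdist_le_of_blockIter_eq_real hk (blockIter_toFinest hk (blockIter k x)).symm
  have h3 : (HiggsLattice.Site.tdist (toFinest (blockIter k x)) (toFinest y') : ℝ) ≤ (P.L : ℝ) ^ k * (HiggsLattice.Site.tdist (blockIter k x) y' : ℝ) := by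
    exact_mod_cast tdist_toFinest_le hk (blockIter k x) y'
  unfold distK
  rw [div_le_iff₀ hℓ]
  have h4 : ((HiggsLattice.Site.tdist (blockIter k x) y' : ℝ) + 1 - ((P.L : ℝ) ^ k)⁻¹) * (P.L : ℝ) ^ k
      = (P.L : ℝ) ^ k * (HiggsLattice.Site.tdist (blockIter k x) y' : ℝ) + ((P.L : ℝ) ^ k - 1) := by
    field_simp
    ring
  rw [h4]
  linarith

/-! ## §3 The cut-off `ζ^{(k)}` and its four properties in the block-label currency -/

/-- **THE CUT-OFF `ζ^{(k)}` OF (2.44) ON THE CARRIER** with support radius `ρ` (block units): r14's clamp profile over `distK`,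
`ζ(x, y′) = max(0, min(1, ρ − 1 − distK(x, y′)))` — a unit ramp ending one block inside radius `ρ`. [cite: Balaban1982Higgs2, (2.44) p.566] -/
def zeta244 (P : HiggsLattice.Params) (k : ℕ) (ρ : ℝ) : HiggsLattice.Site P 0 → HiggsLattice.Site P k → ℝ :=
  zetaClamp (ρ - 1) (distK P k)

/-- Unfolding. [cite: Balaban1982Higgs2, (2.44) p.566] -/
theorem zeta244_apply (ρ : ℝ) (x : HiggsLattice.Site P 0) (y' : HiggsLattice.Site P k) :
    zeta244 P k ρ x y' = max 0 (min 1 (ρ - 1 - distK P k x y')) := rfl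

/-- `0 ≤ ζ`. [cite: Balaban1982Higgs2, (2.44) p.566] -/
theorem zeta244_nonneg (ρ : ℝ) (x : HiggsLattice.Site P 0) (y' : HiggsLattice.Site P k) : 0 ≤ zeta244 P k ρ x y' :=
  (zetaClamp_mem_Icc (ρ - 1) (distK P k) x y').1

/-- `ζ ≤ 1`. [cite: Balaban1982Higgs2, (2.44) p.566] -/
theorem zeta244_le_one (ρ : ℝ) (x : HiggsLattice.Site P 0) (y' : HiggsLattice.Site P k) : zeta244 P k ρ x y' ≤ 1 :=
  (zetaClamp_mem_Icc (ρ - 1) (distK P k) x y').2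

/-- `|ζ| ≤ 1` (the `habs` / `ζ_abs` clause of the consumers). [cite: Balaban1982Higgs2, (2.44) p.566] -/
theorem abs_zeta244_le_one (ρ : ℝ) (x : HiggsLattice.Site P 0) (y' : HiggsLattice.Site P k) : |zeta244 P k ρ x y'| ≤ 1 := by
  rw [abs_of_nonneg (zeta244_nonneg ρ x y')]
  exact zeta244_le_one ρ x y'

/-- **"|(∂^η_xζ^{(k)})(b, y)| ≦ 1"**: `|ζ(x + εe_ν, y′) − ζ(x, y′)| ≤ L^{−k}` — one fine step is `η = L^{−k}` on the unit `k`-lattice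
(the clamp is 1-Lipschitz, `distK` moves by `≤ L^{−k}`); every level `k`, every radius. [cite: Balaban1982Higgs2, (2.44) p.566] -/
theorem zeta244_lip (ρ : ℝ) (x : HiggsLattice.Site P 0) (ν : Fin P.d) (y' : HiggsLattice.Site P k) :
    |zeta244 P k ρ (x.shift ν) y' - zeta244 P k ρ x y'| ≤ ((P.L : ℝ) ^ k)⁻¹ := by
  rw [zeta244_apply, zeta244_apply]
  refine (Literature.NumberTheory.LFunctions.PlateauMollifier.abs_clamp_sub_clamp_le _ _).trans ?_
  have h : ρ - 1 - distK P k (x.shift ν) y' - (ρ - 1 - distK P k x y') = -(distK P k (x.shift ν) y' - distK P k x y') := by ring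
  rw [h, abs_neg]
  exact abs_distK_shift_sub_le x ν y'

/-- **"supp ζ^{(k)}(·, y) ⊂ {|x − y| < ρ}"** in the block-label currency: `ζ(x, y′) ≠ 0 ⇒ |x_k − y′| ≤ ρ` (indeed `≤ ρ − L^{−k}`),
`k ≤ K` (the `hsupp` / `ζ_supp` clause). [cite: Balaban1982Higgs2, (2.44) p.566] -/
theorem zeta244_supp (hk : k ≤ P.K) {ρ : ℝ} {x : HiggsLattice.Site P 0} {y' : HiggsLattice.Site P k} (h : zeta244 P k ρ x y' ≠ 0) :
    (HiggsLattice.Site.tdist (blockIter k x) y' : ℝ) ≤ ρ := by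
  have hlt : distK P k x y' < ρ - 1 := by
    by_contra hle
    rw [not_lt] at hle
    apply h
    rw [zeta244_apply]
    exact max_eq_left (min_le_of_right_le (by linarith))
  have h1 := tdist_blockIter_le_distK hk x y'
  have h2 : 0 ≤ ((P.L : ℝ) ^ k)⁻¹ := inv_nonneg.mpr (pow_nonneg (Nat.cast_nonneg _) _)
  linarith

/-- **"ζ^{(k)}(x, y) = 1 if |x − y| ≦ ρ₁"** in the block-label currency, for any plateau radius `ρ₁` with `ρ₁ + 3 ≤ ρ` (`k ≤ K`; the
`hone` / `ζ_one` clause, printed `ρ₁ = ½r(Lᵏε)`, `ρ = r(Lᵏε)`). [cite: Balaban1982Higgs2, (2.44) p.566] -/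
theorem zeta244_eq_one (hk : k ≤ P.K) {ρ ρ₁ : ℝ} (hρ : ρ₁ + 3 ≤ ρ) {x : HiggsLattice.Site P 0} {y' : HiggsLattice.Site P k}
    (h : (HiggsLattice.Site.tdist (blockIter k x) y' : ℝ) ≤ ρ₁) : zeta244 P k ρ x y' = 1 := by
  have h1 := distK_le_tdist_blockIter hk x y'
  have h2 : 0 ≤ ((P.L : ℝ) ^ k)⁻¹ := inv_nonneg.mpr (pow_nonneg (Nat.cast_nonneg _) _)
  rw [zeta244_apply, min_eq_left (by linarith), max_eq_right zero_le_one]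

/-- **r14's abstract (2.44) predicate ON THE CARRIER**: with the distance `distK` and the difference quotient along the fine bonds
`b = ⟨b₋, b₋ + εe_μ⟩` at mesh `η = L^{−k}`, the clamp `ζ = max(0, min(1, r − 2M − distK))` satisfies `B2StepK.IsCutoff244 … distK r M`
(all three printed requirements, `r ≥ 4M + 2`) — `zetaClamp_isCutoff244` fed with `abs_distK_shift_sub_le`. [cite: Balaban1982Higgs2, (2.44) p.566] -/
theorem isCutoff244_distK (k : ℕ) {r M : ℝ} (hr : 4 * M + 2 ≤ r) :
    B2StepK.IsCutoff244 (zetaClamp (r - 2 * M) (distK P k))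
      (diffQuot ((P.L : ℝ) ^ k)⁻¹ (fun b : HiggsLattice.PBond P 0 => b.src) (fun b : HiggsLattice.PBond P 0 => b.tgt) (zetaClamp (r - 2 * M) (distK P k)))
      (distK P k) r M :=
  zetaClamp_isCutoff244 (inv_pos.mpr (pow_pos (by exact_mod_cast P.hL) k)) (distK P k) _ _
    (fun b y => abs_distK_shift_sub_le b.src b.dir y) hr

/-! ## §4 The printed radius `r(Lᵏε)`: the four clauses of the consumers for `R ≥ 6` -/

/-- `r(s) = R(1 + log s⁻¹)^r ≥ R` for `0 < s ≤ 1`, `R ≥ 0`, `r ≥ 0` (the base is `≥ 1`). [cite: Balaban1982Higgs2, (2.7) p.558] -/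
theorem le_rFn {R r s : ℝ} (hR : 0 ≤ R) (hr : 0 ≤ r) (hs : 0 < s) (hs1 : s ≤ 1) : R ≤ B2.rFn R r s := by
  unfold B2.rFn
  have hu : 1 ≤ 1 + Real.log s⁻¹ := by
    have : 0 ≤ Real.log s⁻¹ := Real.log_nonneg ((one_le_inv₀ hs).mpr hs1)
    linarith
  have h1 : (1 : ℝ) ≤ (1 + Real.log s⁻¹) ^ r := Real.one_le_rpow hu hr
  nlinarith

/-- **(2.44) ON THE CARRIER AT THE PRINTED RADIUS.**  For every torus `P` of the (Higgs)₂,₃ family, every level `k ≤ K` with `Lᵏε ≤ 1`,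
and `R ≥ 6`, `r ≥ 0` ((2.7): *"r > 1, R > R₀"*), the cut-off `ζ^{(k)} := zeta244 k (r(Lᵏε))` has the four properties in the currency of
`B2Lemma23HiggsLattice.lemma23_higgsLattice` (`habs`, `hsupp`, `hone`, `hlip`) = the fields `ζ_abs`, `ζ_supp`, `ζ_one`, `ζ_lip` of
`B2Prop31MinimizerFamily.RMultiM` at level `k`: `|ζ| ≤ 1`; `ζ(x, y′) ≠ 0 ⇒ |x_k − y′| ≤ r(Lᵏε)`; `|x_k − y′| ≤ ½r(Lᵏε) ⇒ ζ(x, y′) = 1`;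
`|ζ(x + εe_ν, y′) − ζ(x, y′)| ≤ L^{−k}`. [cite: Balaban1982Higgs2, (2.44) p.566, (2.7) p.558] -/
theorem zeta244_cutoff244 (hk : k ≤ P.K) {R r : ℝ} (hR : 6 ≤ R) (hr : 0 ≤ r) (hs1 : P.mesh k ≤ 1) :
    (∀ x y', |zeta244 P k (B2.rFn R r (P.mesh k)) x y'| ≤ 1)
    ∧ (∀ x y', zeta244 P k (B2.rFn R r (P.mesh k)) x y' ≠ 0 →
        (HiggsLattice.Site.tdist (blockIter k x) y' : ℝ) ≤ B2.rFn R r (P.mesh k))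
    ∧ (∀ x y', (HiggsLattice.Site.tdist (blockIter k x) y' : ℝ) ≤ B2.rFn R r (P.mesh k) / 2 →
        zeta244 P k (B2.rFn R r (P.mesh k)) x y' = 1)
    ∧ (∀ (x : HiggsLattice.Site P 0) (ν : Fin P.d) (y' : HiggsLattice.Site P k),
        |zeta244 P k (B2.rFn R r (P.mesh k)) (x.shift ν) y' - zeta244 P k (B2.rFn R r (P.mesh k)) x y'| ≤ ((P.L : ℝ) ^ k)⁻¹) := by
  have hρ : 6 ≤ B2.rFn R r (P.mesh k) := hR.trans (le_rFn (by linarith) hr (P.mesh_pos k) hs1)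
  refine ⟨fun x y' => abs_zeta244_le_one _ x y', fun x y' h => zeta244_supp hk h, fun x y' h => ?_,
    fun x ν y' => zeta244_lip _ x ν y'⟩
  exact zeta244_eq_one hk (by linarith) h

/-! ## §5 (v1.1) The printed support set `{|x − y| < r(Lᵏε) − 2M}` with the printed plateau `½r(Lᵏε)` -/

/-- **Strict support**: `ζ(x, y′) ≠ 0 ⇒ |x_k − y′| ≤ ρ − L^{−k} < ρ` (`k ≤ K`). [cite: Balaban1982Higgs2, (2.44) p.566] -/
theorem zeta244_supp_lt (hk : k ≤ P.K) {ρ : ℝ} {x : HiggsLattice.Site P 0} {y' : HiggsLattice.Site P k}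
    (h : zeta244 P k ρ x y' ≠ 0) : (HiggsLattice.Site.tdist (blockIter k x) y' : ℝ) < ρ := by
  have hlt : distK P k x y' < ρ - 1 := by
    by_contra hle
    rw [not_lt] at hle
    apply h
    rw [zeta244_apply]
    exact max_eq_left (min_le_of_right_le (by linarith))
  have h1 := tdist_blockIter_le_distK hk x y'
  have h2 : 0 < ((P.L : ℝ) ^ k)⁻¹ := inv_pos.mpr (pow_pos (by exact_mod_cast P.hL) k)
  linarith

/-- **(2.44) ON THE CARRIER WITH THE PRINTED SUPPORT SET.**  For every torus, every level `k ≤ K` with `Lᵏε ≤ 1`, `M ≥ 0`, `R ≥ 4M + 6`,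
`r ≥ 0`: the cut-off `ζ^{(k)} := zeta244 k (r(Lᵏε) − 2M)` satisfies, verbatim in the block-label currency, *"|(∂^η_xζ^{(k)})(b, y)| ≦ 1,
supp ζ^{(k)}(·, y) is contained in the set {x ∈ T_η : |x − y| < r(Lᵏε) − 2M} and ζ^{(k)}(x, y) = 1 if |x − y| ≦ ½r(Lᵏε)"*, together with
`|ζ| ≤ 1`. [cite: Balaban1982Higgs2, (2.44) p.566, (2.7) p.558] -/
theorem zeta244_cutoff244_printed (hk : k ≤ P.K) {R r M : ℝ} (hM : 0 ≤ M) (hR : 4 * M + 6 ≤ R) (hr : 0 ≤ r)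
    (hs1 : P.mesh k ≤ 1) :
    (∀ x y', |zeta244 P k (B2.rFn R r (P.mesh k) - 2 * M) x y'| ≤ 1)
    ∧ (∀ x y', zeta244 P k (B2.rFn R r (P.mesh k) - 2 * M) x y' ≠ 0 →
        (HiggsLattice.Site.tdist (blockIter k x) y' : ℝ) < B2.rFn R r (P.mesh k) - 2 * M)
    ∧ (∀ x y', (HiggsLattice.Site.tdist (blockIter k x) y' : ℝ) ≤ B2.rFn R r (P.mesh k) / 2 →
        zeta244 P k (B2.rFn R r (P.mesh k) - 2 * M) x y' = 1)
    ∧ (∀ (x : HiggsLattice.Site P 0) (ν : Fin P.d) (y' : HiggsLattice.Site P k),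
        |zeta244 P k (B2.rFn R r (P.mesh k) - 2 * M) (x.shift ν) y'
          - zeta244 P k (B2.rFn R r (P.mesh k) - 2 * M) x y'| ≤ ((P.L : ℝ) ^ k)⁻¹) := by
  have hρ : 4 * M + 6 ≤ B2.rFn R r (P.mesh k) := hR.trans (le_rFn (by linarith) hr (P.mesh_pos k) hs1)
  refine ⟨fun x y' => abs_zeta244_le_one _ x y', fun x y' h => zeta244_supp_lt hk h, fun x y' h => ?_,
    fun x ν y' => zeta244_lip _ x ν y'⟩
  exact zeta244_eq_one hk (by linarith) h

end Literature.MathematicalPhysics.QuantumFieldTheory.Balaban1983to89.B2Eq244Cutoff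

end
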